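import Summits.QuantumFields.YangMills.Theorems.AllWindowsColdBoxBoxHighLineAssemblyFinalStep
import Summits.QuantumFields.YangMills.Theorems.AllWindowsColdBoxBoxWindowHighSU2213LineDefs
import Summits.QuantumFields.YangMills.Theorems.AllWindowsColdBoxBoxHighLineBoxToChartRelativeSupByName
import Summits.QuantumFields.YangMills.Theorems.AllWindowsColdBoxBoxHighLineBoxToChartExponents
import Summits.QuantumFields.YangMills.Theorems.AllWindowsColdBoxBoxHighLineCubicCutBeta
import Summits.QuantumFields.YangMills.Theorems.AllWindowsColdBoxBoxHighLineTiltSupBoundsCubicCut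
import Summits.QuantumFields.YangMills.Theorems.AllWindowsColdBoxBoxHighLineGaussianNormalFormOnCutSet
import Summits.QuantumFields.YangMills.Theorems.AllWindowsColdBoxBoxHighLineTiltCovZeroMainCutSet
import Summits.QuantumFields.YangMills.Theorems.AllWindowsColdBoxBoxHighLineTiltThirdOrderCutSet
import Summits.QuantumFields.YangMills.Theorems.AllWindowsColdBoxBoxHighLineAssemblyEpsTwoThird
import Summits.QuantumFields.YangMills.Theorems.AllWindowsColdBoxBoxHighLineEdgeChartParity
import Summits.QuantumFields.YangMills.Theorems.AllWindowsColdBoxBoxHighLineTiltCum5SizesMuSetU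

/-!
# U5 final bookkeeping, part 2 — `landauThirdOrder_of_sizes (hK3) (hK4) (hK5)` and `landauThirdOrder_of_sizes₂ (hK3) (hK4)` : «stub_landauThirdOrder»
# GENERIC in the open cut-set sizes (planner ym-idea-2 g18, `Cruxes/BoxWindowHighSU2213/ASSEMBLY-U5.md` v0.4 §0/§3/§4, RULING 00:19:54Z «CUT of record»,
# GO 00:34:10Z; skeleton `…/Lines/landau_rung3.lean` v4; LINE-20 U5 ⟨stmt-QuantumFields-24336⟩ — U5 prep, helper-grade; U5 is UNSTAFFED, I23 open)

Width seat `ym-line-sfw-p2-w2` (g33).  Third-order analogue of w3 g40's ✓`landauSecondOrder_of (hK3) (hK4)`: NO new analysis, every inequality a tree theorem by name.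
The sizes still being typed — κ₃,₀ on the cut set (K3′: w3 g41 exact L2 + fcl-p3 g27 split) and κ₄,₀ on the cut set (hC4 ✓p752715 + K4′, LEAD g78) — and κ₅,t
(κ₅′, w5 g24, ALREADY ✓p753055 and discharged here: `AssemblyThird.kappa5_cutSet_size`) enter as hypotheses of the weakest convenient shape: for every
`0 < θ < 1/10` there are `q` (the holder's co-mass exponent) and `K : ℝ → ℕ → ℝ` with (a) for `β ≥ β₀`, `β^θ ≤ H ≤ β^θ + 1` and EVERY measurable symmetric
`D ⊆ smallField H s` (`s = β^{κ₃−1/2}`, `κ₃ = 1/8 − θ/4`) of Gaussian co-mass `E₀[1 − 1_D] ≤ β^{−q}` and `≤ 1/2` carrying `|tiltU β H| ≤ 2`, the cumulant over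
`μ_D := (volume.restrict D).withDensity (ofReal ∘ gaussWeight β H)` between the two chart plaquette costs is `≤ K β H` (all base points; κ₅ for all `t ∈ [0,1]`),
and (b) `∀ ε > 0`, eventually `β²·H⁸·K β H ≤ ε`.  (Adapter for τ-slot statements à la ✓`RestrictionSetCum3/4`: `τ := min (β^{−q}) (1/2)`.)

Chain (ε₁ = ε₂ = 1/8 in ✓`landauRelativeComparisonBulk_of_split`) at the point ✓`BoxToChart.exists_exponents_third`: ε₁-half ✓`boxPlaqCov_sub_chartCov_relative_sup'`;
ε₂-half = cut ✓`SmallFieldFP.exists_beta0_cubicCut` (`q := 3`) + C′/13D′ ✓`abs_chartCov_sub_tiltCov_muCut_one_le_chartPlaqCost` + sup ✓`TiltSup.exists_forall_abs_tiltU_le_on_cubicCut`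
(`|tiltU| ≤ 2`) + 13u³′ ✓`abs_tiltCov_sub_sub_tiltCum3_sub_half_tiltCum4_le_muSet_chartPlaqCost` + `hK3`/`hK4`/`hK5` + 13f₀′ ✓`abs_sq_mul_tiltCov_muSet_zero_sub_main_le` with
τ″ = ✓`gaussAvg_one_sub_indicator_cutSet_le` at the moment order `r(q, θ) = ⌈5q/3⌉₊ + 5` (so `τ″ ≤ β^{−q}`) + floor ✓`boxDirCircSqCov_floor_H` + ✓`eps_two_arith_third` with the rows
✓`cut_budget/f0_budget/tau2_poly_budget/shift_budget/side_budget/budget_monomial`; symmetry of `D ∖ E` by ✓`cubicVertex_neg`/✓`neg_mem_smallField_iff`.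
When K3′/K4′ land, `landauThirdOrder` BY NAME is ONE instantiation of `landauThirdOrder_of_sizes₂` (two binder adapters + two ✓`budget_monomial` rows).

HONEST LABEL: the generic final bookkeeping of the (UNSTAFFED) XL stub U5 of a critic-PASSed DRAFT line, CONDITIONAL on two open size statements; U5
`stub_landauThirdOrder`, ⟨24336⟩, ⟨24004⟩ and the seat's own crux ⟨22884⟩ remain OPEN; route AllWindowsColdBox is DRAFT; no crux, rung or summit is proved;
**the Yang–Mills mass gap is NOT proved by this file; no summit is proved by a line.**
-/

set_option autoImplicit false

noncomputable section

open MeasureTheory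
open Literature.Probability.LatticeModels (Site)
open Literature.MathematicalPhysics.QuantumLattice (fundamentalRep)
open Summit.QuantumFields.YangMills.Theorems.WeakCouplingRates

namespace Summit.QuantumFields.YangMills.Theorems.AllWindowsColdBoxBoxHighLine

namespace AssemblyThird

/-- `r(q, θ)`-arithmetic: for `θ < 1/10` and the moment order `rr := ⌈5q/3⌉₊ + 5`: `(8 + 4rr)θ + 2 < rr` and `4rr·θ + q < rr`. -/
theorem order_arith {θ q : ℝ} (hθ' : θ < 1 / 10) :
    (8 + 4 * ((⌈5 * q / 3⌉₊ + 5 : ℕ) : ℝ)) * θ + 2 < ((⌈5 * q / 3⌉₊ + 5 : ℕ) : ℝ) ∧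
      4 * ((⌈5 * q / 3⌉₊ + 5 : ℕ) : ℝ) * θ + q < ((⌈5 * q / 3⌉₊ + 5 : ℕ) : ℝ) := by
  have hc : 5 * q / 3 ≤ (⌈5 * q / 3⌉₊ : ℝ) := Nat.le_ceil _
  have hc0 : (0 : ℝ) ≤ (⌈5 * q / 3⌉₊ : ℝ) := Nat.cast_nonneg _
  push_cast
  have h1 : (28 + 4 * (⌈5 * q / 3⌉₊ : ℝ)) * θ < (28 + 4 * (⌈5 * q / 3⌉₊ : ℝ)) * (1 / 10) :=
    mul_lt_mul_of_pos_left hθ' (by positivity)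
  have h2 : (4 * ((⌈5 * q / 3⌉₊ : ℝ) + 5)) * θ < (4 * ((⌈5 * q / 3⌉₊ : ℝ) + 5)) * (1 / 10) :=
    mul_lt_mul_of_pos_left hθ' (by positivity)
  constructor
  · nlinarith
  · nlinarith

/-- `β^{−q} ≤ 1/2` for `β ≥ 2`, `q ≥ 1`. -/
theorem rpow_neg_le_half {β q : ℝ} (hβ : 2 ≤ β) (hq : 1 ≤ q) : β ^ (-q) ≤ 1 / 2 := by
  have hβ0 : 0 < β := by linarith
  rw [Real.rpow_neg hβ0.le]
  have h1 : (2 : ℝ) ≤ β ^ q := by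
    calc (2 : ℝ) = 2 ^ (1 : ℝ) := (Real.rpow_one 2).symm
      _ ≤ β ^ (1 : ℝ) := Real.rpow_le_rpow (by norm_num) hβ zero_le_one
      _ ≤ β ^ q := Real.rpow_le_rpow_of_exponent_le (by linarith) hq
  rw [inv_eq_one_div, div_le_div_iff₀ (by linarith) (by norm_num : (0:ℝ) < 2)]
  linarith

/-- The symmetric cut set: `a ∈ smallField H s ∖ E ↔ −a ∈ smallField H s ∖ E` for `E = {λ ≤ |cubicVertex β H ·|}` (✓`cubicVertex_neg`, ✓`neg_mem_smallField_iff`). -/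
theorem neg_mem_cutSet_iff {H : ℕ} (β s lam : ℝ) (a : LandauFree H → E3) :
    -a ∈ smallField H s \ {a | lam ≤ |cubicVertex β H a|} ↔ a ∈ smallField H s \ {a | lam ≤ |cubicVertex β H a|} := by
  simp only [Set.mem_sdiff, Set.mem_setOf_eq, EdgeChartGaussian.neg_mem_smallField_iff, EdgeChartGaussian.cubicVertex_neg, abs_neg]

end AssemblyThird
set_option maxHeartbeats 400000 in
open AssemblyFinal AssemblyBudget AssemblyThird ErrorBudget in
/-- ★★★ **U5 — the stub `stub_landauThirdOrder` BY SHAPE, GENERIC IN THE THREE OPEN CUT-SET SIZES** (`hK3` = κ₃,₀ on the cut set, `hK4` = κ₄,₀ on the cut set,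
`hK5` = κ₅,t on the cut set; each = (a) a bound `K β H` valid eventually at the exponent point of record on EVERY admissible symmetric cut set with Gaussian
co-mass `≤ β^{−q}` (the holder's `q`) and `|tiltU| ≤ 2`, (b) `β²H⁸·K β H → 0`).  For every `θL < 1/10` the BULK relative Dirichlet comparison
`LandauRelativeComparisonBulk θL` follows (the U1–U4 hypotheses of the stub are carried but unused: their content is in the tree by name). -/
theorem landauThirdOrder_of_sizes
    (hK3 : ∀ θ : ℝ, 0 < θ → θ < 1 / 10 → ∃ q : ℝ, ∃ K : ℝ → ℕ → ℝ,
      (∃ β₀ : ℝ, 1 ≤ β₀ ∧ ∀ β : ℝ, β₀ ≤ β → ∀ H : ℕ, 1 ≤ H → β ^ θ ≤ (H : ℝ) → (H : ℝ) ≤ β ^ θ + 1 →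
        ∀ D : Set (LandauFree H → E3), MeasurableSet D → D ⊆ smallField H (β ^ ((1 / 8 - θ / 4) - 1 / 2)) → (∀ a, -a ∈ D ↔ a ∈ D) →
        gaussAvg β H (fun a => 1 - D.indicator (fun _ => (1 : ℝ)) a) ≤ β ^ (-q) →
        gaussAvg β H (fun a => 1 - D.indicator (fun _ => (1 : ℝ)) a) ≤ 1 / 2 → (∀ a ∈ D, |tiltU β H a| ≤ 2) → ∀ x y : Site 4,
        |Tilt.tiltCum3 (((volume : Measure (LandauFree H → E3)).restrict D).withDensity fun a => ENNReal.ofReal (gaussWeight β H a))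
            (tiltU β H) 0 (chartPlaqCost H x 1 2) (chartPlaqCost H y 1 2)| ≤ K β H) ∧
      (∀ ε : ℝ, 0 < ε → ∃ β₀ : ℝ, 1 ≤ β₀ ∧ ∀ β : ℝ, β₀ ≤ β → ∀ H : ℕ, 1 ≤ H → (H : ℝ) ≤ β ^ θ + 1 → β ^ 2 * (H : ℝ) ^ 8 * K β H ≤ ε))
    (hK4 : ∀ θ : ℝ, 0 < θ → θ < 1 / 10 → ∃ q : ℝ, ∃ K : ℝ → ℕ → ℝ,
      (∃ β₀ : ℝ, 1 ≤ β₀ ∧ ∀ β : ℝ, β₀ ≤ β → ∀ H : ℕ, 1 ≤ H → β ^ θ ≤ (H : ℝ) → (H : ℝ) ≤ β ^ θ + 1 →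
        ∀ D : Set (LandauFree H → E3), MeasurableSet D → D ⊆ smallField H (β ^ ((1 / 8 - θ / 4) - 1 / 2)) → (∀ a, -a ∈ D ↔ a ∈ D) →
        gaussAvg β H (fun a => 1 - D.indicator (fun _ => (1 : ℝ)) a) ≤ β ^ (-q) →
        gaussAvg β H (fun a => 1 - D.indicator (fun _ => (1 : ℝ)) a) ≤ 1 / 2 → (∀ a ∈ D, |tiltU β H a| ≤ 2) → ∀ x y : Site 4,
        |Tilt.tiltCum4 (((volume : Measure (LandauFree H → E3)).restrict D).withDensity fun a => ENNReal.ofReal (gaussWeight β H a))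
            (tiltU β H) 0 (chartPlaqCost H x 1 2) (chartPlaqCost H y 1 2)| ≤ K β H) ∧
      (∀ ε : ℝ, 0 < ε → ∃ β₀ : ℝ, 1 ≤ β₀ ∧ ∀ β : ℝ, β₀ ≤ β → ∀ H : ℕ, 1 ≤ H → (H : ℝ) ≤ β ^ θ + 1 → β ^ 2 * (H : ℝ) ^ 8 * K β H ≤ ε))
    (hK5 : ∀ θ : ℝ, 0 < θ → θ < 1 / 10 → ∃ q : ℝ, ∃ K : ℝ → ℕ → ℝ,
      (∃ β₀ : ℝ, 1 ≤ β₀ ∧ ∀ β : ℝ, β₀ ≤ β → ∀ H : ℕ, 1 ≤ H → β ^ θ ≤ (H : ℝ) → (H : ℝ) ≤ β ^ θ + 1 →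
        ∀ D : Set (LandauFree H → E3), MeasurableSet D → D ⊆ smallField H (β ^ ((1 / 8 - θ / 4) - 1 / 2)) → (∀ a, -a ∈ D ↔ a ∈ D) →
        gaussAvg β H (fun a => 1 - D.indicator (fun _ => (1 : ℝ)) a) ≤ β ^ (-q) →
        gaussAvg β H (fun a => 1 - D.indicator (fun _ => (1 : ℝ)) a) ≤ 1 / 2 → (∀ a ∈ D, |tiltU β H a| ≤ 2) → ∀ x y : Site 4,
        ∀ t ∈ Set.Icc (0 : ℝ) 1,
        |Tilt.tiltCum5 (((volume : Measure (LandauFree H → E3)).restrict D).withDensity fun a => ENNReal.ofReal (gaussWeight β H a))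
            (tiltU β H) t (chartPlaqCost H x 1 2) (chartPlaqCost H y 1 2)| ≤ K β H) ∧
      (∀ ε : ℝ, 0 < ε → ∃ β₀ : ℝ, 1 ≤ β₀ ∧ ∀ β : ℝ, β₀ ≤ β → ∀ H : ℕ, 1 ≤ H → (H : ℝ) ≤ β ^ θ + 1 → β ^ 2 * (H : ℝ) ^ 8 * K β H ≤ ε)) :
    ∀ θL : ℝ, θL < 1 / 10 → LandauKernelPackage → LandauRepresentativeBound → LandauBallUniqueness →
      (∃ κ : ℝ, 0 < κ ∧ κ < 1 / 2 - 2 * θL ∧ GaugeBallReduction θL κ) → LandauRelativeComparisonBulk θL := by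
  intro θL hθL _ _ _ _
  refine landauRelativeComparisonBulk_of_split θL fun θ hθ hθle => ?_
  have hθu : θ < 1 / 10 := lt_of_le_of_lt hθle hθL
  have hθ0 : 0 ≤ θ := hθ.le
  -- the exponent point of record
  obtain ⟨κ₃, ε₁, hκ₃, hε₁, hκl, hε₁l, hε₁θ, hε₁u, hε₁u', h6, hK3c, h44, hK4c, hκ₃0, hκ₃8⟩ := BoxToChart.exists_exponents_third hθ hθu
  -- the three sizes at this θ
  obtain ⟨q₃, K₃, ⟨b₃, hb₃1, hK3⟩, hS3⟩ := hK3 θ hθ hθu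
  obtain ⟨q₄, K₄, ⟨b₄, hb₄1, hK4⟩, hS4⟩ := hK4 θ hθ hθu
  obtain ⟨q₅, K₅, ⟨b₅, hb₅1, hK5⟩, hS5⟩ := hK5 θ hθ hθu
  -- the common co-mass exponent and the moment order of the Gaussian-side cut tail
  set q : ℝ := max (max q₃ q₄) (max q₅ 1) with hqdef
  have hq3 : q₃ ≤ q := (le_max_left _ _).trans (le_max_left _ _); have hq4 : q₄ ≤ q := (le_max_right _ _).trans (le_max_left _ _)
  have hq5 : q₅ ≤ q := (le_max_left _ _).trans (le_max_right _ _); have hq1 : 1 ≤ q := (le_max_right _ _).trans (le_max_right _ _)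
  obtain ⟨hr1, hr2⟩ := order_arith (q := q) hθu
  set rr : ℕ := ⌈5 * q / 3⌉₊ + 5 with hrrdef
  have hrr1 : 1 ≤ rr := by rw [hrrdef]; omega
  -- global constants of the by-name inputs
  obtain ⟨C₅, b_cut, hC₅, hbcut1, hcut⟩ := SmallFieldFP.exists_beta0_cubicCut (q := 3) hθ hκ₃0 (by rw [hκ₃]; linarith) (by rw [hκ₃]; linarith)
    (by norm_num)
  obtain ⟨b_sup, hbsup1, hsup⟩ := TiltSup.exists_forall_abs_tiltU_le_on_cubicCut hθ h44 h6 hC₅ 1 one_pos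
  obtain ⟨C₆, c₆, Cw, hc₆, hCw, hτ''⟩ := GaussRestrict.gaussAvg_one_sub_indicator_cutSet_le
  obtain ⟨Cf, hf0⟩ := GaussNormalForm.abs_sq_mul_tiltCov_muSet_zero_sub_main_le
  obtain ⟨Mf, Lf, hMf, hLf, hfloor⟩ := BoxToChart.boxDirCircSqCov_floor_H
  -- 13A′ (the ε₁-half and the letters K, M₁, L₁)
  obtain ⟨K, M₁, L₁, hK, hM₁, hL₁, β₁, hβ₁, hA⟩ := BoxToChart.boxPlaqCov_sub_chartCov_relative_sup' hθ hκl hε₁l hε₁θ hε₁u hε₁u'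
  -- the largeness conditions
  have he : (0 : ℝ) < 3 / (1280 * Real.pi ^ 4) := by positivity
  have h4 : 4 * θ < 1 := (by linarith); have h8 : 8 * θ < 1 := (by linarith); have h2 : 2 * θ < 1 / 2 - κ₃ := (by rw [hκ₃]; linarith)
  obtain hbs := side_budget (c := 1) hθ h4 h2 one_pos 32
  obtain hbC := cut_budget (q := 3) hθ0 (by linarith) he
  obtain hbf := f0_budget (κ₃ := κ₃) hθ0 h8 hκ₃0 hc₆ (half_pos he) C₆ Cf
  obtain hbτp := tau2_poly_budget (r := rr) hθ0 (by exact_mod_cast hr1) (half_pos he) Cw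
  obtain hbsh := shift_budget (κ₃ := κ₃) hθ0 (by rw [hκ₃]; linarith) Cw
  -- `τ″ ≤ β^{-q}`: the polynomial part `≤ β^{-q}/2` and the exponential part `≤ β^{-q}/2`
  obtain hbτq := budget_monomial (a := q - rr) (k := 4 * rr) (j := 0) (κ₃ := κ₃) hθ0 (by push_cast; nlinarith [hr2])
    (by norm_num : (0:ℝ) < 1 / 2) ((4 : ℝ) ^ rr * (2 * rr - 1 : ℝ) ^ (rr * 3) * Cw ^ rr) (3 * rr)
  obtain hbτe := exists_forall_natPow_exp_le hθ0 (by positivity : 0 < 2 * κ₃) hc₆ (by norm_num : (0:ℝ) < 1 / 2) C₆ q 4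
  obtain hb3 := hS3 (3 / (1280 * Real.pi ^ 4)) he
  obtain hb4 := hS4 (2 * (3 / (1280 * Real.pi ^ 4))) (by positivity)
  obtain hb5 := hS5 (6 * (3 / (1280 * Real.pi ^ 4))) (by positivity)
  obtain ⟨βr, hβr, hbr⟩ := exists_beta0_one_le_mul_rpow hK (sub_pos.2 hε₁l)
  have hbr' : ∃ β₀ : ℝ, 1 ≤ β₀ ∧ ∀ β : ℝ, β₀ ≤ β → ∀ _H : ℕ, 1 ≤ K * β ^ (ε₁ - κ₃) := ⟨βr, hβr, fun β hβ _ => hbr β hβ⟩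
  have hb2 : ∃ β₀ : ℝ, 1 ≤ β₀ ∧ ∀ β : ℝ, β₀ ≤ β → ∀ _H : ℕ, (2 : ℝ) ≤ β := ⟨2, by norm_num, fun β hβ _ => hβ⟩
  obtain ⟨β₀, hβ₀, hall⟩ := exists_forall_and ⟨β₁, hβ₁, hA⟩ (exists_forall_and hbs (exists_forall_and hbC (exists_forall_and hbf
    (exists_forall_and hbτp (exists_forall_and hbsh (exists_forall_and hbτq (exists_forall_and hbτe (exists_forall_and hb3
    (exists_forall_and hb4 (exists_forall_and hb5 (exists_forall_and hbr' (exists_forall_and hb2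
    (exists_forall_and ⟨b_cut, hbcut1, hcut⟩ (exists_forall_and ⟨b_sup, hbsup1, hsup⟩
    (exists_forall_and ⟨b₃, hb₃1, hK3⟩ (exists_forall_and ⟨b₄, hb₄1, hK4⟩ ⟨b₅, hb₅1, hK5⟩))))))))))))))))
  clear hA hbs hbC hbf hbτp hbsh hbτq hbτe hb3 hb4 hb5 hbr hbr' hb2 hcut hsup hK3 hK4 hK5 hS3 hS4 hS5
  -- the split data: Φ := β²·(chart covariance over D), M, L, β₀, ε₁' = ε₂' = 1/8
  refine ⟨fun β T => β ^ 2 *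
      ((∫ a in smallField ⌈β ^ θ⌉₊ (β ^ (κ₃ - 1 / 2)),
          chartPlaqCost ⌈β ^ θ⌉₊ (boxCentre ⌈β ^ θ⌉₊) 1 2 a * chartPlaqCost ⌈β ^ θ⌉₊ (boxCentre ⌈β ^ θ⌉₊ + Pi.single 0 (T : ℤ)) 1 2 a *
            fpChartWeight β ⌈β ^ θ⌉₊ (K * ⌈β ^ θ⌉₊ * (1 + Real.log ⌈β ^ θ⌉₊) * β ^ (ε₁ - 1 / 2) +
              2 * (((⌈β ^ θ⌉₊ : ℕ) : ℝ) ^ 2 * (1 + Real.log β) ^ 2 / Real.sqrt β)) a) /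
          (∫ a in smallField ⌈β ^ θ⌉₊ (β ^ (κ₃ - 1 / 2)),
            fpChartWeight β ⌈β ^ θ⌉₊ (K * ⌈β ^ θ⌉₊ * (1 + Real.log ⌈β ^ θ⌉₊) * β ^ (ε₁ - 1 / 2) +
              2 * (((⌈β ^ θ⌉₊ : ℕ) : ℝ) ^ 2 * (1 + Real.log β) ^ 2 / Real.sqrt β)) a) -
        (∫ a in smallField ⌈β ^ θ⌉₊ (β ^ (κ₃ - 1 / 2)),
            chartPlaqCost ⌈β ^ θ⌉₊ (boxCentre ⌈β ^ θ⌉₊) 1 2 a *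
              fpChartWeight β ⌈β ^ θ⌉₊ (K * ⌈β ^ θ⌉₊ * (1 + Real.log ⌈β ^ θ⌉₊) * β ^ (ε₁ - 1 / 2) +
                2 * (((⌈β ^ θ⌉₊ : ℕ) : ℝ) ^ 2 * (1 + Real.log β) ^ 2 / Real.sqrt β)) a) /
            (∫ a in smallField ⌈β ^ θ⌉₊ (β ^ (κ₃ - 1 / 2)),
              fpChartWeight β ⌈β ^ θ⌉₊ (K * ⌈β ^ θ⌉₊ * (1 + Real.log ⌈β ^ θ⌉₊) * β ^ (ε₁ - 1 / 2) +
                2 * (((⌈β ^ θ⌉₊ : ℕ) : ℝ) ^ 2 * (1 + Real.log β) ^ 2 / Real.sqrt β)) a) *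
          ((∫ a in smallField ⌈β ^ θ⌉₊ (β ^ (κ₃ - 1 / 2)),
              chartPlaqCost ⌈β ^ θ⌉₊ (boxCentre ⌈β ^ θ⌉₊ + Pi.single 0 (T : ℤ)) 1 2 a *
                fpChartWeight β ⌈β ^ θ⌉₊ (K * ⌈β ^ θ⌉₊ * (1 + Real.log ⌈β ^ θ⌉₊) * β ^ (ε₁ - 1 / 2) +
                  2 * (((⌈β ^ θ⌉₊ : ℕ) : ℝ) ^ 2 * (1 + Real.log β) ^ 2 / Real.sqrt β)) a) /
            (∫ a in smallField ⌈β ^ θ⌉₊ (β ^ (κ₃ - 1 / 2)),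
              fpChartWeight β ⌈β ^ θ⌉₊ (K * ⌈β ^ θ⌉₊ * (1 + Real.log ⌈β ^ θ⌉₊) * β ^ (ε₁ - 1 / 2) +
                2 * (((⌈β ^ θ⌉₊ : ℕ) : ℝ) ^ 2 * (1 + Real.log β) ^ 2 / Real.sqrt β)) a))),
    max M₁ (8 * Mf), max L₁ Lf, β₀, 1 / 8, 1 / 8, le_max_of_le_left hM₁, by norm_num, ?_, ?_⟩
  · -- the ε₁-half: ✓13A′ verbatim
    intro β hβ T hLT hMT
    obtain ⟨hAβ, -⟩ := hall β hβ T
    have hM : M₁ * (T : ℝ) ≤ (⌈β ^ θ⌉₊ : ℝ) := (mul_le_mul_of_nonneg_right (le_max_left _ _) T.cast_nonneg).trans hMT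
    exact hAβ ((le_max_left _ _).trans hLT) hM ⌈β ^ θ⌉₊ _ _ _ rfl rfl rfl rfl
  · -- the ε₂-half
    intro β hβ T hLT hMT
    have hβ1 : 1 ≤ β := hβ₀.trans hβ
    have hβpos : 0 < β := by linarith only [hβ1]
    obtain ⟨hHl, hHu, hH1⟩ := BoxToChart.ceil_rpow_bounds (θ := θ) hβ1
    obtain ⟨-, hbsβ, hbCβ, hbfβ, hbτpβ, hbshβ, hbτqβ, hbτeβ, hb3β, hb4β, hb5β, hbrβ, hβ2, hcutβ, hsupβ, hK3β, hK4β, hK5β⟩ := hall β hβ ⌈β ^ θ⌉₊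
    clear hall
    dsimp only
    set H : ℕ := ⌈β ^ θ⌉₊ with hHdef
    set s : ℝ := β ^ (κ₃ - 1 / 2) with hsdef
    set r : ℝ := K * (H : ℝ) * (1 + Real.log (H : ℝ)) * β ^ (ε₁ - 1 / 2) + 2 * ((H : ℝ) ^ 2 * (1 + Real.log β) ^ 2 / Real.sqrt β) with hrdef
    have hse : β ^ (-1 / 2 + κ₃) = s := by rw [hsdef]; congr 1; ring
    have hse' : β ^ ((1 / 8 - θ / 4) - 1 / 2) = s := by rw [hsdef, hκ₃]
    have hs0 : 0 < s := by rw [hsdef]; exact Real.rpow_pos_of_pos hβpos _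
    clear_value H s r
    have hH1' : (1 : ℝ) ≤ H := by exact_mod_cast hH1
    have hH0 : (0 : ℝ) < H := (by linarith only [hH1']); have hH8 : (0 : ℝ) < (H : ℝ) ^ 8 := pow_pos hH0 8
    -- side conditions at this β
    obtain ⟨hH4β, hsH2, h252, h32, hs1⟩ := hbsβ hH1 hHl hHu
    have hsπ : s < Real.pi := lt_of_le_of_lt hs1 (by linarith only [Real.pi_gt_three])
    have hKβ : 1 ≤ K * β ^ (ε₁ - κ₃) := hbrβ
    -- `s ≤ r` and `0 < r`
    have hlogH : 0 ≤ Real.log (H : ℝ) := Real.log_nonneg hH1'; have hspl : 0 < β ^ (ε₁ - 1 / 2) := Real.rpow_pos_of_pos hβpos _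
    have hgap : 0 ≤ 2 * ((H : ℝ) ^ 2 * (1 + Real.log β) ^ 2 / Real.sqrt β) := by positivity
    have hsr : s ≤ r := by
      have h1 : s ≤ K * β ^ (ε₁ - 1 / 2) := by
        have h := mul_le_mul_of_nonneg_left hKβ hs0.le
        rw [mul_one] at h; refine h.trans (le_of_eq ?_); rw [hsdef, mul_left_comm, ← Real.rpow_add hβpos]; congr 2; ring
      have h2 : K * β ^ (ε₁ - 1 / 2) ≤ K * (H : ℝ) * (1 + Real.log (H : ℝ)) * β ^ (ε₁ - 1 / 2) := by
        have hHL : (1 : ℝ) ≤ (H : ℝ) * (1 + Real.log (H : ℝ)) :=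
          one_le_mul_of_one_le_of_one_le hH1' (by linarith only [hlogH])
        have := mul_le_mul_of_nonneg_left hHL (mul_nonneg hK.le hspl.le)
        calc K * β ^ (ε₁ - 1 / 2) = K * β ^ (ε₁ - 1 / 2) * 1 := by ring
          _ ≤ K * β ^ (ε₁ - 1 / 2) * ((H : ℝ) * (1 + Real.log (H : ℝ))) := this
          _ = _ := by ring
      rw [hrdef]
      linarith only [h1, h2, hgap]
    have hr : 0 < r := lt_of_lt_of_le hs0 hsr
    -- the cut event and the cut set
    set E : Set (LandauFree H → E3) := {a | 1 + C₅ * β * (H : ℝ) ^ 4 * s ^ 5 ≤ |cubicVertex β H a|} with hEdef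
    have hEm : MeasurableSet E := SmallFieldFP.measurableSet_cubicCut β C₅ s 1
    have hD'm : MeasurableSet (smallField H s \ E) := (ChartGauss.measurableSet_smallField s).diff hEm
    have hD'sub : smallField H s \ E ⊆ smallField H s := Set.sdiff_subset
    have hD'sym : ∀ a, -a ∈ smallField H s \ E ↔ a ∈ smallField H s \ E := fun a => neg_mem_cutSet_iff β s _ a
    -- the FP-side cut mass `τ_c = β^{-3}`
    have hcut' : ∫ a in smallField H s ∩ E, fpChartWeight β H r a ≤ β ^ (-(3 : ℝ)) * ∫ a in smallField H s \ E, fpChartWeight β H r a := by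
      have h := hcutβ hH1 hHu r (by rw [hse]; exact hsr)
      rw [hse] at h
      exact h
    have hτc0 : 0 ≤ β ^ (-(3 : ℝ)) := Real.rpow_nonneg hβpos.le _; have hτc2 : β ^ (-(3 : ℝ)) ≤ 1 / 2 := rpow_neg_le_half hβ2 (by norm_num)
    -- the sup bound on the cut set
    have hU2 : ∀ a ∈ smallField H s \ E, |tiltU β H a| ≤ 2 := by
      intro a ha
      have h := hsupβ hH1 hHu a (by rw [hse]; exact ha.1) (by
        rw [hse]
        have hna := ha.2
        simp only [hEdef, Set.mem_setOf_eq, not_le] at hna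
        exact hna)
      linarith only [h]
    -- the Gaussian-side co-mass `τ″ ≤ β^{-q} ≤ 1/2`
    have hshift : Cw * β * (H : ℝ) ^ 4 * s ^ 5 ≤ 1 / 2 := hbshβ hH1 hHu
    have hτ''β := hτ'' H hH1 β s hβpos hs0 hshift C₅ hC₅ rr hrr1
    set τ'' : ℝ := C₆ * (H : ℝ) ^ 4 * Real.exp (-(c₆ * β * s ^ 2)) +
      (4 : ℝ) ^ rr * ((2 * rr - 1 : ℝ) ^ (rr * 3) * (Cw * (H : ℝ) ^ 4 * (1 + Real.log H) ^ 3 / β) ^ rr) with hτ''def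
    have hτq : τ'' ≤ β ^ (-q) := by
      have hp := hbτqβ hH1 hHu
      have hex := hbτeβ hH1 hHu
      simp only [pow_zero, mul_one] at hp
      -- polynomial part
      have hp' : (4 : ℝ) ^ rr * ((2 * rr - 1 : ℝ) ^ (rr * 3) * (Cw * (H : ℝ) ^ 4 * (1 + Real.log H) ^ 3 / β) ^ rr) ≤ 1 / 2 * β ^ (-q) := by
        rw [cubicTail_pow_eq hβpos rr]
        have hβq' : β ^ (q - (rr : ℝ)) * β ^ (-q) = β ^ (-(rr : ℝ)) := by rw [← Real.rpow_add hβpos]; congr 1; ring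
        calc (4 : ℝ) ^ rr * ((2 * rr - 1 : ℝ) ^ (rr * 3) * (Cw ^ rr * (H : ℝ) ^ (4 * rr) * (1 + Real.log H) ^ (3 * rr) * β ^ (-(rr : ℝ))))
            = ((4 : ℝ) ^ rr * (2 * rr - 1 : ℝ) ^ (rr * 3) * Cw ^ rr * (H : ℝ) ^ (4 * rr) * (1 + Real.log H) ^ (3 * rr) * β ^ (q - rr)) *
                β ^ (-q) := by rw [← hβq']; ring
          _ ≤ 1 / 2 * β ^ (-q) := mul_le_mul_of_nonneg_right hp (Real.rpow_nonneg hβpos.le _)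
      -- exponential part
      have he' : C₆ * (H : ℝ) ^ 4 * Real.exp (-(c₆ * β * s ^ 2)) ≤ 1 / 2 * β ^ (-q) := by
        have hβs : c₆ * β * s ^ 2 = c₆ * β ^ (2 * κ₃) := by
          rw [hsdef, rpow_pow_eq hβpos.le, mul_assoc, ← Real.rpow_one_add' hβpos.le (by push_cast; linarith)]
          congr 2; push_cast; ring
        rw [hβs]
        have hid : C₆ * (H : ℝ) ^ 4 * Real.exp (-(c₆ * β ^ (2 * κ₃))) = (C₆ * (H : ℝ) ^ 4 * β ^ q * Real.exp (-(c₆ * β ^ (2 * κ₃)))) * β ^ (-q) := by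
          rw [Real.rpow_neg hβpos.le]
          field_simp
        rw [hid]
        exact mul_le_mul_of_nonneg_right hex (Real.rpow_nonneg hβpos.le _)
      rw [hτ''def]
      linarith only [hp', he']
    have hτhalf : τ'' ≤ 1 / 2 := hτq.trans (rpow_neg_le_half hβ2 hq1)
    have hτ''le : gaussAvg β H (fun a => 1 - (smallField H s \ E).indicator (fun _ => (1 : ℝ)) a) ≤ τ'' := hτ''β
    have hτD2 : gaussAvg β H (fun a => 1 - (smallField H s \ E).indicator (fun _ => (1 : ℝ)) a) ≤ 1 / 2 := hτ''le.trans hτhalf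
    have hτDq : ∀ q' : ℝ, q' ≤ q → gaussAvg β H (fun a => 1 - (smallField H s \ E).indicator (fun _ => (1 : ℝ)) a) ≤ β ^ (-q') := fun q' hq' =>
      (hτ''le.trans hτq).trans (Real.rpow_le_rpow_of_exponent_le hβ1 (by linarith))
    -- the FP operator of the chart is invertible on D (for 13D′)
    have hdet := GaussNormalForm.det_fpOperator_edgeChart_ne_zero (H := H) hH1 hs0.le hs1 h252
    -- generalize the second base point
    generalize hy : boxCentre H + Pi.single 0 (T : ℤ) = y
    -- C′ + 13D′ : chart covariance over D versus the tilted covariance at t = 1 over μ_{D ∖ E}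
    have hC := GaussNormalForm.abs_chartCov_sub_tiltCov_muCut_one_le_chartPlaqCost (β := β) hH1 hβpos.le hs0 hsr hsπ hr hdet hEm hτc0 hcut' hτc2
      (boxCentre H) y
    -- the three sizes on the cut set
    have hK5i := hK5β hH1 hHl hHu (smallField H s \ E) hD'm (by rw [hse']; exact hD'sub) hD'sym (hτDq q₅ hq5) hτD2 hU2 (boxCentre H) y
    have hK3i := hK3β hH1 hHl hHu (smallField H s \ E) hD'm (by rw [hse']; exact hD'sub) hD'sym (hτDq q₃ hq3) hτD2 hU2 (boxCentre H) y
    have hK4i := hK4β hH1 hHl hHu (smallField H s \ E) hD'm (by rw [hse']; exact hD'sub) hD'sym (hτDq q₄ hq4) hτD2 hU2 (boxCentre H) y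
    -- 13u³′
    have h13u := GaussNormalForm.abs_tiltCov_sub_sub_tiltCum3_sub_half_tiltCum4_le_muSet_chartPlaqCost hβpos hD'm hτ''le hτhalf hU2
      (boxCentre H) y hK5i
    -- 13f₀′
    have hf := hf0 H hH1 β hβ1 (smallField H s \ E) hD'm τ'' hτ''le hτhalf T
    rw [hy] at hf
    -- budgets at this β
    have bC := hbCβ hH1 hHu; have bK3 := hb3β hH1 hHu
    have bK4 : β ^ 2 * (H : ℝ) ^ 8 * (K₄ β H / 2) ≤ 3 / (1280 * Real.pi ^ 4) := by have h := hb4β hH1 hHu; linarith only [h]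
    have bK5 : β ^ 2 * (H : ℝ) ^ 8 * (K₅ β H / 6) ≤ 3 / (1280 * Real.pi ^ 4) := by have h := hb5β hH1 hHu; linarith only [h]
    have bf0 : (96 * τ'' * β ^ 2 + Cf / β) * (H : ℝ) ^ 8 ≤ 3 / (1280 * Real.pi ^ 4) := by
      have h1 := hbfβ hH1 hHu
      have h2 := hbτpβ hH1 hHu
      rw [hτ''def, f0_shape_split]
      linarith only [h1, h2]
    -- the floor on the bulk window
    have hMT' : Mf * (T : ℝ) ≤ (H : ℝ) / 8 := by
      have h1 : 8 * Mf * (T : ℝ) ≤ (H : ℝ) := (mul_le_mul_of_nonneg_right (le_max_right _ _) T.cast_nonneg).trans hMT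
      linarith only [h1]
    have hLT' : Lf ≤ (T : ℝ) := (le_max_right _ _).trans hLT
    have hfl := hfloor H h32 T hMT' hLT'
    have hfl' : 40 * (3 / (1280 * Real.pi ^ 4)) / (H : ℝ) ^ 8 ≤ 3 / 4 * boxDirCircSqCov H T := by
      refine le_trans (le_of_eq ?_) hfl; field_simp; ring
    exact eps_two_arith_third hH8 hC h13u hK3i hK4i hf bC bK5 bK3 bK4 bf0 hfl'

/-! ## The κ₅ size on the cut set is ALREADY by name (w5 g24 ✓p753055): `hK5` discharged -/

namespace AssemblyThird

open AssemblyBudget in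
/-- ★★ **`hK5` of `landauThirdOrder_of_sizes` HOLDS** — w5 g24's ✓`GaussNormalForm.exists_beta0_abs_tiltCum5_muSet_le` (κ₅ over `μ_{D′}` for every measurable
`D′ ⊆ smallField H s` with `|tiltU| ≤ B` on `D′` and Gaussian mass `≥ 1/2`; here `B = 2`, `κ₃ = 1/8 − θ/4`, so `4θ + 4κ₃ < 1` and `2θ + 5κ₃ < 1` for `θ < 1/10`)
gives the bound, and ✓`AssemblyBudget.k5_budget` (`14θ < 3/2`, `14θ + 3κ₃ < 5/2`) the smallness `β²H⁸·K → 0` (co-mass exponent `q := 1`, unused). -/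
theorem kappa5_cutSet_size : ∀ θ : ℝ, 0 < θ → θ < 1 / 10 → ∃ q : ℝ, ∃ K : ℝ → ℕ → ℝ,
      (∃ β₀ : ℝ, 1 ≤ β₀ ∧ ∀ β : ℝ, β₀ ≤ β → ∀ H : ℕ, 1 ≤ H → β ^ θ ≤ (H : ℝ) → (H : ℝ) ≤ β ^ θ + 1 →
        ∀ D : Set (LandauFree H → E3), MeasurableSet D → D ⊆ smallField H (β ^ ((1 / 8 - θ / 4) - 1 / 2)) → (∀ a, -a ∈ D ↔ a ∈ D) →
        gaussAvg β H (fun a => 1 - D.indicator (fun _ => (1 : ℝ)) a) ≤ β ^ (-q) →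
        gaussAvg β H (fun a => 1 - D.indicator (fun _ => (1 : ℝ)) a) ≤ 1 / 2 → (∀ a ∈ D, |tiltU β H a| ≤ 2) → ∀ x y : Site 4,
        ∀ t ∈ Set.Icc (0 : ℝ) 1,
        |Tilt.tiltCum5 (((volume : Measure (LandauFree H → E3)).restrict D).withDensity fun a => ENNReal.ofReal (gaussWeight β H a))
            (tiltU β H) t (chartPlaqCost H x 1 2) (chartPlaqCost H y 1 2)| ≤ K β H) ∧
      (∀ ε : ℝ, 0 < ε → ∃ β₀ : ℝ, 1 ≤ β₀ ∧ ∀ β : ℝ, β₀ ≤ β → ∀ H : ℕ, 1 ≤ H → (H : ℝ) ≤ β ^ θ + 1 → β ^ 2 * (H : ℝ) ^ 8 * K β H ≤ ε) := by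
  intro θ hθ hθu
  obtain ⟨C, m, hC0, β₅, hβ₅, h⟩ := GaussNormalForm.exists_beta0_abs_tiltCum5_muSet_le (θ := θ) (κ₃ := 1 / 8 - θ / 4) hθ.le (by linarith)
    (by linarith) (by linarith)
  have hexp : (-1 / 2 + (1 / 8 - θ / 4) : ℝ) = (1 / 8 - θ / 4) - 1 / 2 := by ring
  refine ⟨1, fun β H => C * Real.exp (4 * 2) * (1 + Real.log H) ^ m *
      (((1 + Real.log H) ^ 2 / β ^ 2 + (β ^ ((1 / 8 - θ / 4) - 1 / 2)) ^ 3 / (β * Real.sqrt β)) * ((H : ℝ) ^ 6 / (β * Real.sqrt β))),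
    ⟨β₅, hβ₅, ?_⟩, ?_⟩
  · intro β hβ H hH _ hHu D hDm hDs _ _ hτ2 hU x y t ht
    have hβpos : 0 < β := lt_of_lt_of_le one_pos (hβ₅.trans hβ)
    have hb := h β hβ H hH hHu D hDm (by rw [hexp]; exact hDs) 2 (by norm_num) hU
      (GaussRestrict.half_le_gaussAvg_indicator hβpos hDm hτ2 le_rfl) x y t ht
    rw [hexp] at hb
    exact hb
  · intro ε hε
    obtain ⟨β₀, hβ₀, hb⟩ := k5_budget (θ := θ) (κ₃ := 1 / 8 - θ / 4) hθ.le (by linarith) (by linarith) (by positivity : 0 < ε / 6)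
      (C * Real.exp (4 * 2)) m
    refine ⟨β₀, hβ₀, fun β hβ H hH hHu => ?_⟩
    have h1 := hb β hβ H hH hHu
    have hid : β ^ 2 * (H : ℝ) ^ 8 * (C * Real.exp (4 * 2) * (1 + Real.log H) ^ m *
        (((1 + Real.log H) ^ 2 / β ^ 2 + (β ^ ((1 / 8 - θ / 4) - 1 / 2)) ^ 3 / (β * Real.sqrt β)) * ((H : ℝ) ^ 6 / (β * Real.sqrt β)))) =
        6 * (β ^ 2 * (H : ℝ) ^ 8 / 6 * (C * Real.exp (4 * 2) * (1 + Real.log H) ^ m *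
          (((1 + Real.log H) ^ 2 / β ^ 2 + (β ^ ((1 / 8 - θ / 4) - 1 / 2)) ^ 3 / (β * Real.sqrt β)) * ((H : ℝ) ^ 6 / (β * Real.sqrt β))))) := by
      ring
    rw [hid]
    linarith only [h1]

end AssemblyThird

/-- ★★★ **U5 BY SHAPE, CONDITIONAL ON THE TWO REMAINING CUT-SET SIZES `hK3` (κ₃,₀: w3 g41 exact L2 + fcl-p3 g27 K3′-split) and `hK4` (κ₄,₀: LEAD g78, C4 ✓p752715 +
K4′-split)** — `hK5` is discharged by w5 g24's ✓κ₅′ (`AssemblyThird.kappa5_cutSet_size`). -/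
theorem landauThirdOrder_of_sizes₂
    (hK3 : ∀ θ : ℝ, 0 < θ → θ < 1 / 10 → ∃ q : ℝ, ∃ K : ℝ → ℕ → ℝ,
      (∃ β₀ : ℝ, 1 ≤ β₀ ∧ ∀ β : ℝ, β₀ ≤ β → ∀ H : ℕ, 1 ≤ H → β ^ θ ≤ (H : ℝ) → (H : ℝ) ≤ β ^ θ + 1 →
        ∀ D : Set (LandauFree H → E3), MeasurableSet D → D ⊆ smallField H (β ^ ((1 / 8 - θ / 4) - 1 / 2)) → (∀ a, -a ∈ D ↔ a ∈ D) →
        gaussAvg β H (fun a => 1 - D.indicator (fun _ => (1 : ℝ)) a) ≤ β ^ (-q) →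
        gaussAvg β H (fun a => 1 - D.indicator (fun _ => (1 : ℝ)) a) ≤ 1 / 2 → (∀ a ∈ D, |tiltU β H a| ≤ 2) → ∀ x y : Site 4,
        |Tilt.tiltCum3 (((volume : Measure (LandauFree H → E3)).restrict D).withDensity fun a => ENNReal.ofReal (gaussWeight β H a))
            (tiltU β H) 0 (chartPlaqCost H x 1 2) (chartPlaqCost H y 1 2)| ≤ K β H) ∧
      (∀ ε : ℝ, 0 < ε → ∃ β₀ : ℝ, 1 ≤ β₀ ∧ ∀ β : ℝ, β₀ ≤ β → ∀ H : ℕ, 1 ≤ H → (H : ℝ) ≤ β ^ θ + 1 → β ^ 2 * (H : ℝ) ^ 8 * K β H ≤ ε))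
    (hK4 : ∀ θ : ℝ, 0 < θ → θ < 1 / 10 → ∃ q : ℝ, ∃ K : ℝ → ℕ → ℝ,
      (∃ β₀ : ℝ, 1 ≤ β₀ ∧ ∀ β : ℝ, β₀ ≤ β → ∀ H : ℕ, 1 ≤ H → β ^ θ ≤ (H : ℝ) → (H : ℝ) ≤ β ^ θ + 1 →
        ∀ D : Set (LandauFree H → E3), MeasurableSet D → D ⊆ smallField H (β ^ ((1 / 8 - θ / 4) - 1 / 2)) → (∀ a, -a ∈ D ↔ a ∈ D) →
        gaussAvg β H (fun a => 1 - D.indicator (fun _ => (1 : ℝ)) a) ≤ β ^ (-q) →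
        gaussAvg β H (fun a => 1 - D.indicator (fun _ => (1 : ℝ)) a) ≤ 1 / 2 → (∀ a ∈ D, |tiltU β H a| ≤ 2) → ∀ x y : Site 4,
        |Tilt.tiltCum4 (((volume : Measure (LandauFree H → E3)).restrict D).withDensity fun a => ENNReal.ofReal (gaussWeight β H a))
            (tiltU β H) 0 (chartPlaqCost H x 1 2) (chartPlaqCost H y 1 2)| ≤ K β H) ∧
      (∀ ε : ℝ, 0 < ε → ∃ β₀ : ℝ, 1 ≤ β₀ ∧ ∀ β : ℝ, β₀ ≤ β → ∀ H : ℕ, 1 ≤ H → (H : ℝ) ≤ β ^ θ + 1 → β ^ 2 * (H : ℝ) ^ 8 * K β H ≤ ε)) :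
    ∀ θL : ℝ, θL < 1 / 10 → LandauKernelPackage → LandauRepresentativeBound → LandauBallUniqueness →
      (∃ κ : ℝ, 0 < κ ∧ κ < 1 / 2 - 2 * θL ∧ GaugeBallReduction θL κ) → LandauRelativeComparisonBulk θL :=
  landauThirdOrder_of_sizes hK3 hK4 AssemblyThird.kappa5_cutSet_size

end Summit.QuantumFields.YangMills.Theorems.AllWindowsColdBoxBoxHighLine

end
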